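import Mathlib.RepresentationTheory.Homological.GroupCohomology.Functoriality
import HarnessLib

/-!
# Additivity of `Hⁿ(G, -)` in the morphism and vanishing on retracts of direct sums

Topic `Algebra/Homology`; namespace `Literature.Algebra.Homology`.  A *proofs* file (theorems
only, Mathlib only).

* `map_id_add`, `map_id_zero`, `map_id_neg`, `map_id_sum`: `groupCohomology.map (MonoidHom.id G)`
  is additive in the morphism of coefficients (Mathlib has the functor but no `Additive`
  instance for it; we go through `cochainsFunctor` and `HomologicalComplex.homologyMap_add`).
* `map_id_eq_zero_of_retract`: if `B` is a retract of a finite direct sum of copies of `A`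
  inside `Rep k G` — morphisms `πᵢ : B ⟶ A`, `eᵢ : A ⟶ B` with `∑ᵢ πᵢ ≫ eᵢ = 𝟙 B` — and the
  endomorphisms `P` of `A`, `P'` of `B` satisfy `P' ≫ πᵢ = πᵢ ≫ P`, then `Hⁿ(G, P) = 0`
  implies `Hⁿ(G, P') = 0`.  Use: a Hecke operator (or a polynomial in Hecke operators) killing
  `Hⁿ(X, k)` kills `Hⁿ(X, N)` for every finite free `k`-module `N` of coefficients (`N ≅ kᵈ`,
  coordinates and basis vectors), the passage from `ℤ/p^m` to `M_ξ/p^m ≅ (ℤ/p^m)ᵈ` in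
  [Scholze2015, §V.4, proof of Thm. V.4.1] ("`ℳ_{ξ,K}/p^m` is a direct sum of copies of `ℤ/p^mℤ`").

## References

* K. S. Brown, *Cohomology of Groups*, GTM 87 (1982), III §6 (additivity/compatibility with
  direct sums) [Brown1982CohomologyGroups].
* P. Scholze, Ann. of Math. 182 (2015), §V.4, proof of Thm. V.4.1 [Scholze2015].
-/

noncomputable section

open CategoryTheory groupCohomology

universe u

namespace Literature.Algebra.Homology

variable {k G : Type u} [CommRing k] [Group G] {A B : Rep k G}

/-- `Hⁿ(G, φ + ψ) = Hⁿ(G, φ) + Hⁿ(G, ψ)`. [cite: Brown1982CohomologyGroups, III §6] -/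
theorem map_id_add (φ ψ : A ⟶ B) (n : ℕ) :
    groupCohomology.map (MonoidHom.id G) (φ + ψ) n =
      groupCohomology.map (MonoidHom.id G) φ n + groupCohomology.map (MonoidHom.id G) ψ n := by
  change HomologicalComplex.homologyMap ((cochainsFunctor k G).map (φ + ψ)) n =
    HomologicalComplex.homologyMap ((cochainsFunctor k G).map φ) n +
      HomologicalComplex.homologyMap ((cochainsFunctor k G).map ψ) n
  rw [(cochainsFunctor k G).map_add, HomologicalComplex.homologyMap_add]

/-- `Hⁿ(G, 0) = 0`. [folklore] -/
theorem map_id_zero (n : ℕ) : groupCohomology.map (MonoidHom.id G) (0 : A ⟶ B) n = 0 := by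
  change HomologicalComplex.homologyMap ((cochainsFunctor k G).map 0) n = 0
  rw [(cochainsFunctor k G).map_zero, HomologicalComplex.homologyMap_zero]

/-- `Hⁿ(G, -φ) = -Hⁿ(G, φ)`. [folklore] -/
theorem map_id_neg (φ : A ⟶ B) (n : ℕ) :
    groupCohomology.map (MonoidHom.id G) (-φ) n = -groupCohomology.map (MonoidHom.id G) φ n := by
  rw [eq_neg_iff_add_eq_zero, ← map_id_add, neg_add_cancel, map_id_zero]

/-- `Hⁿ(G, ∑ᵢ φᵢ) = ∑ᵢ Hⁿ(G, φᵢ)`. [cite: Brown1982CohomologyGroups, III §6] -/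
theorem map_id_sum {ι : Type*} (s : Finset ι) (φ : ι → (A ⟶ B)) (n : ℕ) :
    groupCohomology.map (MonoidHom.id G) (∑ i ∈ s, φ i) n =
      ∑ i ∈ s, groupCohomology.map (MonoidHom.id G) (φ i) n := by
  classical
  induction s using Finset.induction_on with
  | empty => rw [Finset.sum_empty, Finset.sum_empty, map_id_zero]
  | insert i s hi ih => rw [Finset.sum_insert hi, Finset.sum_insert hi, map_id_add, ih]

/-- **Vanishing on retracts of direct sums.**  Let `πᵢ : B ⟶ A`, `eᵢ : A ⟶ B` (`i` in a finite
type) with `∑ᵢ πᵢ ≫ eᵢ = 𝟙 B` (so `B` is a retract of `⊕ᵢ A`), and let `P ∈ End A`, `P' ∈ End B`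
with `P' ≫ πᵢ = πᵢ ≫ P` for all `i`.  If `Hⁿ(G, P) = 0` then `Hⁿ(G, P') = 0`
(`P' = ∑ᵢ πᵢ ≫ P ≫ eᵢ` and `Hⁿ` is additive). [cite: Scholze2015, §V.4, proof of Thm. V.4.1] -/
theorem map_id_eq_zero_of_retract {ι : Type*} [Fintype ι] (π : ι → (B ⟶ A)) (e : ι → (A ⟶ B))
    (hsum : ∑ i, π i ≫ e i = 𝟙 B) {P : A ⟶ A} {P' : B ⟶ B} (hcomm : ∀ i, P' ≫ π i = π i ≫ P)
    (n : ℕ) (hP : groupCohomology.map (MonoidHom.id G) P n = 0) :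
    groupCohomology.map (MonoidHom.id G) P' n = 0 := by
  have hP' : P' = ∑ i, π i ≫ P ≫ e i := by
    calc P' = P' ≫ 𝟙 B := (Category.comp_id _).symm
      _ = ∑ i, P' ≫ π i ≫ e i := by rw [← hsum, Preadditive.comp_sum]
      _ = ∑ i, π i ≫ P ≫ e i :=
          Finset.sum_congr rfl fun i _ => by rw [← Category.assoc, hcomm i, Category.assoc]
  rw [hP', map_id_sum]
  refine Finset.sum_eq_zero fun i _ => ?_
  rw [map_id_comp, map_id_comp, hP, Limits.zero_comp, Limits.comp_zero]

end Literature.Algebra.Homology
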